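import Literature.NumberTheory.Transcendental.DeRhamTheorem
import Literature.NumberTheory.Transcendental.FormsAlgebra
import HarnessLib

/-!
# Wedge powers of a `2`-form

Layer `Literature/Geometry/Kaehler`. The wedge powers `ωᵖ = ω ∧ ⋯ ∧ ω` of a `2`-form, in degree
`2 * p` (no `ℕ`-subtraction), both pointwise on a normed space (`ContinuousAlternatingMap.twoPow`)
and for forms on a manifold (`MForm.twoFormPow`, with `ω⁰ = 1`, `ωᵖ⁺¹ = (ωᵖ ∧ ω).castDeg`), in the
format of `kaehlerFormPow` of `Literature/AlgebraicGeometry/Motives/HodgeDecomposition` (which is the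
case `ω = ω_g`, `kaehlerFormPow g p = twoFormPow ω_g p` definitionally) but for an ARBITRARY `2`-form —
needed for the powers `θ'ᵖ` of auxiliary closed `2`-forms that are not Kähler forms of a metric (the
pulled-back Fubini–Study form of a LOWER-dimensional projective space, whose top power vanishes).
PROVED API (Warner (1983), 2.6, 2.17, 2.20, 2.22):

* `ContinuousAlternatingMap.twoPow`, `twoPow_compContinuousLinearMap` (powers commute with linear
  pull-back);
* `MForm.twoFormPow`, `twoFormPow_apply` (pointwise it is `twoPow`), `twoFormPow_pullback`
  (commutes with pull-back along maps), `isSmoothForm_twoFormPow`, `twoFormPow_mem_closedSmoothForms`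
  (powers of a closed smooth form are closed smooth, Leibniz);
* `twoFormPow_sub_twoFormPow_mem_exactSmoothForms` — **if two closed `2`-forms differ by an exact
  form then so do all their powers**: `ωᵖ⁺¹ − ω'ᵖ⁺¹ = (ωᵖ − ω'ᵖ) ∧ ω + ω'ᵖ ∧ (ω − ω')`, exact ∧ closed
  and closed ∧ exact being exact (Warner 2.20; no graded commutativity is used). This is the
  cohomological statement `[ω]ᵖ = [ω']ᵖ`, at the level of forms on a possibly non-compact manifold
  (e.g. an open submanifold), where it is consumed (`[θ]ᵖ` dies off a linear section).

## References

* F. W. Warner, *Foundations of Differentiable Manifolds and Lie Groups*, GTM 94 (1983), 2.6, 2.17,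
  2.20, 2.22. [WarnerGTM94]
* R. Bott, L. Tu, *Differential Forms in Algebraic Topology* (1982), §I.1–I.2. [BottTu1982Forms]
-/

noncomputable section

open scoped Manifold ContDiff
open Set

/-! ## Part 1. Pointwise powers -/

namespace ContinuousAlternatingMap

variable {𝕜 : Type*} [RCLike 𝕜] {V W : Type*} [NormedAddCommGroup V] [NormedSpace 𝕜 V]
  [NormedAddCommGroup W] [NormedSpace 𝕜 W]
  {A : Type*} [NormedCommRing A] [NormedAlgebra 𝕜 A]

/-- **The wedge powers `aᵖ` of an alternating `2`-form**, of degree `2 * p`: `a⁰ = 1`,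
`aᵖ⁺¹ = aᵖ ∧ a` (reindexed along `2 * p + 2 = 2 * (p + 1)`). [cite: WarnerGTM94, 2.6] -/
def twoPow (a : V [⋀^Fin 2]→L[𝕜] A) : (p : ℕ) → V [⋀^Fin (2 * p)]→L[𝕜] A
  | 0 => (constOfIsEmpty 𝕜 V (Fin 0) (1 : A)).domDomCongr (finCongr (Nat.mul_zero 2).symm)
  | p + 1 => ((twoPow a p).wedge a).domDomCongr (finCongr (Nat.mul_succ 2 p).symm)

/-- `a⁰ = 1` (definitional). [folklore] -/
theorem twoPow_zero (a : V [⋀^Fin 2]→L[𝕜] A) :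
    a.twoPow 0 = (constOfIsEmpty 𝕜 V (Fin 0) (1 : A)).domDomCongr (finCongr (Nat.mul_zero 2).symm) :=
  rfl

/-- `aᵖ⁺¹ = aᵖ ∧ a` (definitional, with the reindexing). [folklore] -/
theorem twoPow_succ (a : V [⋀^Fin 2]→L[𝕜] A) (p : ℕ) :
    a.twoPow (p + 1) = ((a.twoPow p).wedge a).domDomCongr (finCongr (Nat.mul_succ 2 p).symm) :=
  rfl

/-- Reindexing commutes with linear pull-back. [folklore] -/
theorem domDomCongr_compContinuousLinearMap {ι ι' : Type*} [Fintype ι] [Fintype ι']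
    (f : V [⋀^ι]→L[𝕜] A) (σ : ι ≃ ι') (g : W →L[𝕜] V) :
    (f.domDomCongr σ).compContinuousLinearMap g = (f.compContinuousLinearMap g).domDomCongr σ := by
  ext v
  rfl

/-- **Powers commute with linear pull-back**: `(a ∘ g)ᵖ = aᵖ ∘ g` (the wedge is natural under
precomposition, `wedge_compContinuousLinearMap`). [cite: WarnerGTM94, 2.22] -/
theorem twoPow_compContinuousLinearMap (a : V [⋀^Fin 2]→L[𝕜] A) (g : W →L[𝕜] V) (p : ℕ) :
    (a.compContinuousLinearMap g).twoPow p = (a.twoPow p).compContinuousLinearMap g := by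
  induction p with
  | zero =>
    rw [twoPow_zero, twoPow_zero, domDomCongr_compContinuousLinearMap]
    rfl
  | succ p ih =>
    rw [twoPow_succ, twoPow_succ, ih, ← wedge_compContinuousLinearMap, domDomCongr_compContinuousLinearMap]

end ContinuousAlternatingMap

/-! ## Part 2. Powers of a `2`-form on a manifold -/

namespace Literature.Geometry.Kaehler

namespace MForm

variable {E : Type*} [NormedAddCommGroup E] [NormedSpace ℝ E]
  {H : Type*} [TopologicalSpace H] {I : ModelWithCorners ℝ E H}
  {M : Type*} [TopologicalSpace M] [ChartedSpace H M]
  {A : Type*} [NormedCommRing A] [NormedAlgebra ℝ A]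

variable (I M) in
/-- **The wedge powers `ωᵖ` of a `2`-form on a manifold**, of degree `2 * p`: `ω⁰ = 1`,
`ωᵖ⁺¹ = (ωᵖ ∧ ω).castDeg` (same recursion as `kaehlerFormPow`, for an arbitrary `2`-form).
[cite: WarnerGTM94, 2.17] -/
def twoFormPow (θ : MForm I M A 2) : (p : ℕ) → MForm I M A (2 * p)
  | 0 => (MForm.const I M (1 : A)).castDeg (Nat.mul_zero 2).symm
  | p + 1 => ((twoFormPow θ p).wedge θ).castDeg (Nat.mul_succ 2 p).symm

/-- `ω⁰ = 1` (definitional). [folklore] -/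
theorem twoFormPow_zero (θ : MForm I M A 2) :
    twoFormPow I M θ 0 = (MForm.const I M (1 : A)).castDeg (Nat.mul_zero 2).symm :=
  rfl

/-- `ωᵖ⁺¹ = (ωᵖ ∧ ω).castDeg` (definitional). [folklore] -/
theorem twoFormPow_succ (θ : MForm I M A 2) (p : ℕ) :
    twoFormPow I M θ (p + 1) = ((twoFormPow I M θ p).wedge θ).castDeg (Nat.mul_succ 2 p).symm :=
  rfl

/-- **Pointwise, `ωᵖ` is the power of the value**: `(ωᵖ) x = (ω x)ᵖ`. [cite: WarnerGTM94, 2.17] -/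
theorem twoFormPow_apply (θ : MForm I M A 2) (p : ℕ) (x : M) :
    twoFormPow I M θ p x = (letI a : E [⋀^Fin 2]→L[ℝ] A := θ x; (a.twoPow p : E [⋀^Fin (2 * p)]→L[ℝ] A)) := by
  induction p with
  | zero => rfl
  | succ p ih =>
    rw [twoFormPow_succ, ContinuousAlternatingMap.twoPow_succ]
    change (letI b : E [⋀^Fin (2 * p + 2)]→L[ℝ] A :=
        (letI c : E [⋀^Fin (2 * p)]→L[ℝ] A := twoFormPow I M θ p x
         letI a : E [⋀^Fin 2]→L[ℝ] A := θ x
         (c.wedge a : E [⋀^Fin (2 * p + 2)]→L[ℝ] A));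
      (b.domDomCongr (finCongr (Nat.mul_succ 2 p).symm) : E [⋀^Fin (2 * (p + 1))]→L[ℝ] A)) = _
    rw [ih]

end MForm

/-! ### Pull-back, smoothness, closedness -/

section Calculus

variable {E : Type*} [NormedAddCommGroup E] [NormedSpace ℝ E]
  {H : Type*} [TopologicalSpace H] {I : ModelWithCorners ℝ E H}
  {M : Type*} [TopologicalSpace M] [ChartedSpace H M]
  {E' : Type*} [NormedAddCommGroup E'] [NormedSpace ℝ E']
  {H' : Type*} [TopologicalSpace H'] {I' : ModelWithCorners ℝ E' H'}
  {N : Type*} [TopologicalSpace N] [ChartedSpace H' N]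
  {A : Type*} [NormedCommRing A] [NormedAlgebra ℝ A]

/-- **Powers commute with pull-back along maps**: `f^*(ωᵖ) = (f^*ω)ᵖ` (pull-back is compatible with
`∧` and with degree casts). [cite: WarnerGTM94, 2.22] -/
theorem MForm.twoFormPow_pullback (f : M → N) (θ : MForm I' N A 2) (p : ℕ) :
    (MForm.twoFormPow I' N θ p).pullback I f = MForm.twoFormPow I M (θ.pullback I f) p := by
  induction p with
  | zero => rw [MForm.twoFormPow_zero, MForm.twoFormPow_zero, MForm.pullback_castDeg, MForm.pullback_const]
  | succ p ih =>
    rw [MForm.twoFormPow_succ, MForm.twoFormPow_succ, MForm.pullback_castDeg, MForm.pullback_wedge, ih]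

open Literature.NumberTheory.Transcendental

/-- `(α − β) ∧ γ = α ∧ γ − β ∧ γ` for forms. [cite: WarnerGTM94, 2.6] -/
theorem MForm.sub_wedge {k l : ℕ} (α β : MForm I M A k) (γ : MForm I M A l) :
    (α - β).wedge γ = α.wedge γ - β.wedge γ := by
  rw [sub_eq_add_neg, MForm.wedge_add_left, sub_eq_add_neg, ← neg_one_smul ℝ β, MForm.wedge_smul_left,
    neg_one_smul]

/-- `α ∧ (β − γ) = α ∧ β − α ∧ γ` for forms. [cite: WarnerGTM94, 2.6] -/
theorem MForm.wedge_sub {k l : ℕ} (α : MForm I M A k) (β γ : MForm I M A l) :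
    α.wedge (β - γ) = α.wedge β - α.wedge γ := by
  rw [sub_eq_add_neg, MForm.wedge_add_right, sub_eq_add_neg, ← neg_one_smul ℝ γ, MForm.wedge_smul_right,
    neg_one_smul]

/-- Degree casts commute with subtraction. [folklore] -/
theorem MForm.castDeg_sub {k k' : ℕ} (h : k = k') (α β : MForm I M A k) :
    (α - β).castDeg h = α.castDeg h - β.castDeg h := by
  subst h
  rfl


/-- Powers of a smooth `2`-form are smooth. [cite: WarnerGTM94, 2.17] -/
theorem isSmoothForm_twoFormPow [WedgeFacts I M A] {θ : MForm I M A 2} (hθ : IsSmoothForm θ) (p : ℕ) :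
    IsSmoothForm (MForm.twoFormPow I M θ p) := by
  induction p with
  | zero =>
    rw [MForm.twoFormPow_zero]
    exact isSmoothForm_castDeg _ (isSmoothForm_const 1)
  | succ p ih =>
    rw [MForm.twoFormPow_succ]
    exact isSmoothForm_castDeg _ (isSmoothForm_wedge ih hθ)

/-- **Powers of a closed smooth `2`-form are closed smooth forms** (Leibniz, Warner 2.20).
[cite: WarnerGTM94, 2.20] -/
theorem twoFormPow_mem_closedSmoothForms [WedgeFacts I M A] {θ : MForm I M A 2}
    (hθ : θ ∈ closedSmoothForms I M A 2) (p : ℕ) :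
    MForm.twoFormPow I M θ p ∈ closedSmoothForms I M A (2 * p) := by
  induction p with
  | zero =>
    rw [MForm.twoFormPow_zero]
    exact castDeg_mem_closedSmoothForms _ (const_mem_closedSmoothForms 1)
  | succ p ih =>
    rw [MForm.twoFormPow_succ]
    exact castDeg_mem_closedSmoothForms _ (wedge_mem_closedSmoothForms ih hθ)

/-- **Cohomologous closed `2`-forms have cohomologous powers, at the level of forms.** If `ω`, `ω'`
are closed smooth `2`-forms with `ω − ω'` exact, then `ωᵖ − ω'ᵖ` is exact for every `p`:
`ωᵖ⁺¹ − ω'ᵖ⁺¹ = (ωᵖ − ω'ᵖ) ∧ ω + ω'ᵖ ∧ (ω − ω')`, and exact ∧ closed, closed ∧ exact are exact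
(Warner 2.20; Bott–Tu §I.1: the wedge descends to cohomology). No graded commutativity is used, so the
statement holds on any manifold carrying the wedge calculus, e.g. an open submanifold.
[cite: WarnerGTM94, 2.20] -/
theorem twoFormPow_sub_twoFormPow_mem_exactSmoothForms [WedgeFacts I M A] {θ θ' : MForm I M A 2}
    (hθ : θ ∈ closedSmoothForms I M A 2) (hθ' : θ' ∈ closedSmoothForms I M A 2)
    (h : θ - θ' ∈ exactSmoothForms I M A 2) (p : ℕ) :
    MForm.twoFormPow I M θ p - MForm.twoFormPow I M θ' p ∈ exactSmoothForms I M A (2 * p) := by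
  induction p with
  | zero =>
    rw [MForm.twoFormPow_zero, MForm.twoFormPow_zero, sub_self]
    exact zero_mem _
  | succ p ih =>
    have key : MForm.twoFormPow I M θ (p + 1) - MForm.twoFormPow I M θ' (p + 1) =
        (((MForm.twoFormPow I M θ p - MForm.twoFormPow I M θ' p).wedge θ) +
          (MForm.twoFormPow I M θ' p).wedge (θ - θ')).castDeg (Nat.mul_succ 2 p).symm := by
      rw [MForm.twoFormPow_succ, MForm.twoFormPow_succ, ← MForm.castDeg_sub, MForm.sub_wedge,
        MForm.wedge_sub, sub_add_sub_cancel]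
    rw [key]
    exact castDeg_mem_exactSmoothForms _ (add_mem (wedge_mem_exactSmoothForms_of_left ih hθ)
      (wedge_mem_exactSmoothForms_of_right (twoFormPow_mem_closedSmoothForms hθ' p) h))

/-- In particular, **if a closed smooth `2`-form `ω` differs from a closed smooth `ω'` with `ω'ᵖ = 0`
by an exact form, then `ωᵖ` is exact.** [cite: WarnerGTM94, 2.20] -/
theorem twoFormPow_mem_exactSmoothForms_of_sub_of_eq_zero [WedgeFacts I M A] {θ θ' : MForm I M A 2}
    (hθ : θ ∈ closedSmoothForms I M A 2) (hθ' : θ' ∈ closedSmoothForms I M A 2)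
    (h : θ - θ' ∈ exactSmoothForms I M A 2) {p : ℕ} (h0 : MForm.twoFormPow I M θ' p = 0) :
    MForm.twoFormPow I M θ p ∈ exactSmoothForms I M A (2 * p) := by
  have h' := twoFormPow_sub_twoFormPow_mem_exactSmoothForms hθ hθ' h p
  rwa [h0, sub_zero] at h'

end Calculus

end Literature.Geometry.Kaehler

end
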